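import Mathlib
import Literature.AlgebraicGeometry.Resolution.CobordantChartCoefficients

/-!
# `WeightedInvariant.WeightedConstruction`, line `weighted-oblique-fuel`: the general fuel lemma

Route `ResolutionOfSingularities/WeightedInvariant`, crux `WeightedConstruction`
(stmt-ResolutionOfSingularities-0571), stub `stub_fuelLemma` of the lead's skeleton
`work/WeightedConstruction.lean`, PROVED here (statement verbatim from the ledger registration).

**Setting.** `k` a field, `F ∈ k[[x₁, …, xₘ]]`, weights `w : Fin m → ℕ` and an exceptional point
`c : Fin m → k` of the weighted cobordant blow-up (`cᵢ = 0` whenever `wᵢ = 0`).  The chart is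
`CobordantChart.chart w c : xᵢ ↦ s^{wᵢ} (cᵢ + yᵢ)` (`s = X 0`, `yᵢ = X i.succ`) and the transform
factors as `F(s^w(c+y)) = s^d · T'`.  FUEL at `c` for the modulus `q` is an exponent `α` in the
support of `F` with `q ∣ αₗ` whenever `cₗ = 0` and `q ∣ w·α`.

**Statement (GENERAL FUEL LEMMA).** If there is no fuel at `c` and `q ∣ d`, then `T'` has no
monomial `s^r y^β'` with `q ∣ r` and `q ∣ β'ᵢ` for all `i`: every coefficient of `T'` at an
exponent `β` with `q ∣ β l` for all `l` vanishes.  (Characteristic-free combinatorics; in the line it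
says that at a fuel-free exceptional point `q`-cleaning does nothing to the successor.)

**Proof.** Write `β = cons r β'` (`r = β 0`, `β' = tail β`).  By
`CobordantChart.coeff_cons_of_eq_X_pow_mul`, `coeff (cons r β') T' = coeff (cons (d + r) β') F(s^w(c+y))`,
and by THE COEFFICIENT FORMULA `CobordantChart.coeff_subst_chart` this is the finitely supported sum
over exponents `α` of `[w·α = d + r] · F_α · ∏ᵢ C(αᵢ, β'ᵢ) cᵢ^{αᵢ - β'ᵢ}`.  Every summand vanishes:
if `w·α = d + r`, `F_α ≠ 0` and all factors `C(αᵢ, β'ᵢ) cᵢ^{αᵢ - β'ᵢ}` are non-zero, then for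
`cᵢ = 0` we get `αᵢ = β'ᵢ` (`C(αᵢ, β'ᵢ) ≠ 0` forces `β'ᵢ ≤ αᵢ`, and `0^{αᵢ - β'ᵢ} ≠ 0` forces
`αᵢ ≤ β'ᵢ`), so `q ∣ αᵢ = β (i.succ)`, and `q ∣ w·α = d + r` from `q ∣ d`, `q ∣ r = β 0`:
`α` is fuel, contradicting the hypothesis.
-/

set_option linter.dupNamespace false -- mandated namespace of this single-conjunct summit

namespace Summit.ResolutionOfSingularities.ResolutionOfSingularities.Theorems

open Literature.AlgebraicGeometry.Resolution

/-- A non-vanishing Taylor factor `C(a, b) · x^{a - b}` with `x = 0` forces `a = b`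
(`C(a, b) ≠ 0 ⇒ b ≤ a`, `0^{a - b} ≠ 0 ⇒ a ≤ b`). -/
private theorem eq_of_choose_mul_pow_ne_zero {k : Type*} [Field k] {a b : ℕ} {x : k}
    (h : ((a.choose b : ℕ) : k) * x ^ (a - b) ≠ 0) (hx : x = 0) : a = b := by
  by_contra hne
  rcases Nat.lt_or_gt_of_ne hne with hlt | hgt
  · exact h (by rw [Nat.choose_eq_zero_of_lt hlt, Nat.cast_zero, zero_mul])
  · exact h (by rw [hx, zero_pow (by omega), mul_zero])

/-- GENERAL FUEL LEMMA: at an exceptional point `c` without fuel for `F` (no `α ∈ supp F` with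
`q ∣ αₗ` for all `l` with `cₗ = 0` and `q ∣ w·α`), the `s`-saturated transform `T'`
(`F(s^w(c+y)) = s^d T'`, `q ∣ d`) has no `q`-th-power monomial at all. -/
theorem stub_fuelLemma : ∀ (q : ℕ) (k : Type) [Field k] (m : ℕ) (F : MvPowerSeries (Fin m) k) (w : Fin m → ℕ) (c : Fin m → k), (∀ i, w i = 0 → c i = 0) → ∀ (d : ℕ) (T' : MvPowerSeries (Fin (m + 1)) k), q ∣ d → MvPowerSeries.subst (CobordantChart.chart w c) F = MvPowerSeries.X 0 ^ d * T' → (¬ ∃ α : Fin m →₀ ℕ, MvPowerSeries.coeff α F ≠ 0 ∧ (∀ l, c l = 0 → q ∣ α l) ∧ q ∣ Finsupp.weight w α) → ∀ β : Fin (m + 1) →₀ ℕ, (∀ l, q ∣ β l) → MvPowerSeries.coeff β T' = 0 := by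
  intro q k _ m F w c hc d T' hqd hfac hnofuel β hβ
  classical
  -- `β = cons (β 0) (tail β)`; pass to the coefficient of `F(s^w(c+y))` and expand it.
  rw [← Finsupp.cons_tail β, CobordantChart.coeff_cons_of_eq_X_pow_mul hfac,
    CobordantChart.coeff_subst_chart w c hc]
  apply finsum_eq_zero_of_forall_eq_zero
  intro α
  split_ifs with hwα
  · by_cases hFα : MvPowerSeries.coeff α F = 0
    · rw [hFα, zero_mul]
    -- otherwise some Taylor factor vanishes, for else `α` would be fuel
    suffices h : ∃ j, ((α j).choose (Finsupp.tail β j) : k) * c j ^ (α j - Finsupp.tail β j) = 0 by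
      obtain ⟨j, hj⟩ := h
      rw [Finset.prod_eq_zero (Finset.mem_univ j) hj, mul_zero]
    by_contra hall
    push Not at hall
    refine hnofuel ⟨α, hFα, fun l hl => ?_, ?_⟩
    · rw [eq_of_choose_mul_pow_ne_zero (hall l) hl, Finsupp.tail_apply]
      exact hβ l.succ
    · rw [hwα]
      exact dvd_add hqd (hβ 0)
  · rfl

end Summit.ResolutionOfSingularities.ResolutionOfSingularities.Theorems
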